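import Summits.BirchSwinnertonDyer.BirchSwinnertonDyer.Theses.UniversalToricDescent
import Summits.BirchSwinnertonDyer.BirchSwinnertonDyer.Theorems.CumulativeHeegnerLeopoldtCumulativeHeegnerInclusionAtThreeLayerTower
import Summits.BirchSwinnertonDyer.BirchSwinnertonDyer.Theorems.CumulativeHeegnerLeopoldtCumulativeHeegnerInclusionAtThreeLayerFitting
import Summits.BirchSwinnertonDyer.BirchSwinnertonDyer.Theorems.CumulativeHeegnerLeopoldtCumulativeHeegnerInclusionAtThreeStubThreeSaturation
import Summits.BirchSwinnertonDyer.BirchSwinnertonDyer.Theorems.UniversalToricDescentAcDualMuZeroCriterion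
import HarnessLib

/-!
# Crux idea `layer-fitting-transfer` for THE WALL `AdditiveSplitIMCInclusionAtThree`
# (stmt-BirchSwinnertonDyer-20395, route UniversalToricDescent) — typed first lemmas (ideation seat
# bsd-wall-utd-idea g34; SKETCH, evidence only; no definition of the route is touched; no `sorry`)

TRANSFER at crux level (lens `transfer`): the sibling route `CumulativeHeegnerLeopoldt` (reducible-`E[3]`
Leopoldt cell) landed TODAY the LAYER-TOWER door for its Heegner-side inclusion K1/A (stmt-24198/26896):
`…CumulativeHeegnerInclusionAtThreeLayerTower` (13:28Z), `…LayerFitting` / `…LayerFittingDoor` (the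
Mazur–Tate door in equivariant currency over `Λ ⧸ (ω_m) = ℤ₃[Gal(K_m/K)]`), `…LayerControl*`,
`…LayerTowerLocalAnnihilatorDoor`. Their research residue is [R-layer-KS] (layer theta elements from an
equivariant Kolyvagin argument with RESIDUALLY REDUCIBLE `E[3]`) + [R-layer-rec].

This file states the SAME doors at the frame of the UTD wall (surjective `ρ̄_{E,3}`), BY NAME from the
sibling's route-independent lemmas (`mem_of_forall_mem_sup_layer`, `map_fittingIdeal_le_map_charIdeal`,
`forall_pow_mul_mem_map_fittingIdeal_sup_layer_of_quotientFitting`, `span_le_span_of_span_pow_three_mul_le`)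
and UTD's own Greenberg criterion (`isTorsion_and_exists_generator_of_finite_pTorsion`):

* `IntegralCharLayerTowerAtThreeSurj` and `additiveSplitIMCInclusionAtThree_iff_integralCharLayerTower` —
  the wall IS its integral layer tower (`∀ m, L ∈ Ch·R₀⟦T⟧ + (3^m) + (ω_m)`): an EQUIVALENCE, hence immune
  by construction to the full-range-shadow barrier B-g33-1 (orders / values / λ / μ at all layers do not
  certify the wall; layer IDEALS do — for the recorded witness `g = T² − 3 ∤ L = T² − 12` the first
  separating layer is `m = 3`: in `Λ/(g) = ℤ₃[√3]`, `(3^m, ω_m(√3)) = (√3)^{2m}` and `L ≡ −9`).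
* `MazurTateTowerAtThreeSurj` (**the transferred crux C⁺**, displayed not constructed): at every UTD
  frame `∃ μ ∃ (θ_m) ∀ m, θ̄_m ∈ Fitt_{Λ/(ω_m)}(X ⧸ ω_m X) ∧ 3^μ·L ∈ (θ_m) + (3^m) + (ω_m)`,
  `X = X_{∅,0}(𝔭′)`; `FittingLayerTowerAtThreeSurj` ((LT) at the UTD frame);
  `fittingLayerTower_of_mazurTateTower` (C⁺ ⟹ (LT), exponent preserved).
* `additiveSplitIMCInclusionAtThree_of_residualFinite_of_fittingLayerTower` /
  `…_of_residualFinite_of_mazurTateTower` — (LT) resp. C⁺, together with finiteness of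
  `Sel_{𝔭′}(K_∞, E[3^∞])[3]` at `E` (`ResidualSelmerFiniteAtThreeSurj`: on this route the OUTPUT of the
  mod-3 transport from the twin, read through `finite_pTorsion_of_isTorsion_of_exists_generator`; displayed
  here), give the wall 20395 verbatim (Krull door + `Fitt ⊆ Ch` + saturation at `3`).
* `additiveSplitIMCInclusionAtThree_of_integralMazurTateTower` — the integral (`μ = 0`) C⁺ gives 20395
  with NO finiteness input.

Why the transfer has teeth HERE (card `Ideas/idea-layer-fitting-transfer.md`): on the surjective cell the
layer Kolyvagin input is print-grade — Sakamoto, JTNB 36 (2024) Thm 4.4 allows ANY zero-dimensional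
Gorenstein `𝔽₃`-algebra `R` (here `R = ℤ/3^k[Gal(K_m/K)]`) under (H.1) `E[3]` irreducible, (H.2), (H.3),
(H.SD) (Weil pairing) — exactly what fails on the sibling's reducible cell; so the m-UNIFORMITY budget of
the line reduces to the finite-layer reciprocity at `𝔭` ([R-layer-rec]: `θ_m ≡ u·3^μ·L`), a LOCAL statement
in the Leopoldt coordinates of `Ê(K_{m,𝔓}) ≅ 𝔪_{K_{m,𝔓}}`. Nothing about the existence of the `θ_m` is
asserted here; BSD is not proved by any of this; the wall 20395 stays OPEN.

References: [MazurTate1987] §1; [Sakamoto2024] Thm 4.4 (p. 926); [KimKurihara2021] §1;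
[BertoliniDarmon1990] §2; [StacksProject] Tags 00IP, 07ZA; [SkinnerUrban2014] §3.1.6;
Darmon, Invent. Math. 110 (1992) 123–146 (doi:10.1007/bf01231327).
-/

set_option linter.dupNamespace false
set_option autoImplicit false

noncomputable section

open scoped Classical

namespace Summit.BirchSwinnertonDyer.BirchSwinnertonDyer.Cruxes.AdditiveSplitIMCInclusionAtThree.LayerFittingTransfer

open NumberField IsDedekindDomain
open Literature.NumberTheory.EllipticCurves Literature.RingTheory.FittingIdeal
open Summit.BirchSwinnertonDyer.Rank1Residual.X11b Summit.BirchSwinnertonDyer.Rank1Residual.X11b.AcSelmer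
open Summit.BirchSwinnertonDyer.BirchSwinnertonDyer.Theorems.CumulativeHeegnerInclusionAtThreeLayerTower
open Summit.BirchSwinnertonDyer.BirchSwinnertonDyer.Theorems.CumulativeHeegnerInclusionAtThreeLayerFitting
open Summit.BirchSwinnertonDyer.BirchSwinnertonDyer.Theorems.CumulativeHeegnerInclusionAtThreeSaturation
open Summit.BirchSwinnertonDyer.BirchSwinnertonDyer.Theorems.UniversalToricDescentAcDualMuZero

/-! ### §1 The statements at the UTD frame (binders of `AdditiveSplitIMCInclusionAtThree`, verbatim) -/

/-- **Integral `Ch`-layer tower** at the UTD frame: `∀ m, L ∈ Ch_Λ(X_{∅,0}(𝔭′))·R₀⟦T⟧ + (3^m) + (ω_m)`. -/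
def IntegralCharLayerTowerAtThreeSurj : Prop :=
  ∀ (W : WeierstrassCurve ℚ) [W.IsElliptic] [W.IsGloballyMinimal] (N : ℕ) [NeZero N] (K : Type) [Field K] [NumberField K] (Dt : Literature.NumberTheory.EllipticCurves.ModularForms.ModularParametrizationData W N), Summit.BirchSwinnertonDyer.Rank1Residual.Additive.ClassO6 W 3 → W.HasSurjectiveModNGaloisRep 3 → W.analyticRank = 1 → W.conductorNorm ℤ = N → Literature.NumberTheory.EllipticCurves.IsImaginaryQuadratic K → Literature.NumberTheory.EllipticCurves.SatisfiesHeegnerHypothesis N K → ∀ (κ : Literature.NumberTheory.EllipticCurves.ZpExtension K 3), κ.IsAnticyclotomic → ∀ (γ : Field.absoluteGaloisGroup K) [Fact (κ.IsTopGenerator γ)] (𝔭 : IsDedekindDomain.HeightOneSpectrum (NumberField.RingOfIntegers K)), ((3 : ℕ) : NumberField.RingOfIntegers K) ∈ 𝔭.asIdeal → 𝔭.asIdeal.ramificationIdx (NumberField.RingOfIntegers ℚ) = 1 → 𝔭.asIdeal.inertiaDeg (NumberField.RingOfIntegers ℚ) = 1 → ∀ (𝔭' : IsDedekindDomain.HeightOneSpectrum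 (NumberField.RingOfIntegers K)), ((3 : ℕ) : NumberField.RingOfIntegers K) ∈ 𝔭'.asIdeal → 𝔭' ≠ 𝔭 → ∀ (ι' : PadicAlgCl 3 ≃+* ℂ), Summit.BirchSwinnertonDyer.BirchSwinnertonDyer.Theorems.SchneiderFree.BranchInducesPrime 3 ι' 𝔭 → ∀ (ΩK : ℂ) (Ωp : ℂ_[3]) (L : Literature.NumberTheory.EllipticCurves.UnrSeries 3), ΩK ≠ 0 → Ωp ≠ 0 → Literature.NumberTheory.EllipticCurves.IsBDPLFunction ι' 𝔭 κ γ Dt.f ΩK Ωp L → ∀ m : ℕ, L ∈ (Summit.BirchSwinnertonDyer.Rank1Residual.X11b.AcSelmer.XAc.charIdeal (W.baseChange K) 3 κ 𝔭' ∅ γ).map (PowerSeries.map (Summit.BirchSwinnertonDyer.Rank1Residual.X11b.Halves.toUnr 3)) ⊔ Ideal.span {((3 : ℕ) : Literature.NumberTheory.EllipticCurves.UnrSeries 3) ^ m} ⊔ Ideal.span {((1 + PowerSeries.X) ^ (3 ^ m) - 1 : Literature.NumberTheory.EllipticCurves.UnrSeries 3)}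

/-- **(LT) at the UTD frame — the tempered FITTING layer tower**:
`∃ μ ∀ m, 3^μ · L ∈ Fitt_Λ(X_{∅,0}(𝔭′))·R₀⟦T⟧ + (3^m) + (ω_m)`. -/
def FittingLayerTowerAtThreeSurj : Prop :=
  ∀ (W : WeierstrassCurve ℚ) [W.IsElliptic] [W.IsGloballyMinimal] (N : ℕ) [NeZero N] (K : Type) [Field K] [NumberField K] (Dt : Literature.NumberTheory.EllipticCurves.ModularForms.ModularParametrizationData W N), Summit.BirchSwinnertonDyer.Rank1Residual.Additive.ClassO6 W 3 → W.HasSurjectiveModNGaloisRep 3 → W.analyticRank = 1 → W.conductorNorm ℤ = N → Literature.NumberTheory.EllipticCurves.IsImaginaryQuadratic K → Literature.NumberTheory.EllipticCurves.SatisfiesHeegnerHypothesis N K → ∀ (κ : Literature.NumberTheory.EllipticCurves.ZpExtension K 3), κ.IsAnticyclotomic → ∀ (γ : Field.absoluteGaloisGroup K) [Fact (κ.IsTopGenerator γ)] (𝔭 : IsDedekindDomain.HeightOneSpectrum (NumberField.RingOfIntegers K)), ((3 : ℕ) : NumberField.RingOfIntegers K) ∈ 𝔭.asIdeal → 𝔭.asIdeal.ramificationIdx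 (NumberField.RingOfIntegers ℚ) = 1 → 𝔭.asIdeal.inertiaDeg (NumberField.RingOfIntegers ℚ) = 1 → ∀ (𝔭' : IsDedekindDomain.HeightOneSpectrum (NumberField.RingOfIntegers K)), ((3 : ℕ) : NumberField.RingOfIntegers K) ∈ 𝔭'.asIdeal → 𝔭' ≠ 𝔭 → ∀ (ι' : PadicAlgCl 3 ≃+* ℂ), Summit.BirchSwinnertonDyer.BirchSwinnertonDyer.Theorems.SchneiderFree.BranchInducesPrime 3 ι' 𝔭 → ∀ (ΩK : ℂ) (Ωp : ℂ_[3]) (L : Literature.NumberTheory.EllipticCurves.UnrSeries 3), ΩK ≠ 0 → Ωp ≠ 0 → Literature.NumberTheory.EllipticCurves.IsBDPLFunction ι' 𝔭 κ γ Dt.f ΩK Ωp L → ∃ μ : ℕ, ∀ m : ℕ, ((3 : ℕ) : Literature.NumberTheory.EllipticCurves.UnrSeries 3) ^ μ * L ∈ (Literature.RingTheory.FittingIdeal.Module.fittingIdeal (Literature.NumberTheory.EllipticCurves.IwasawaAlgebra 3) (Summit.BirchSwinnertonDyer.Rank1Residual.X11b.AcSelmer.XAc (W.baseChange K) 3 κ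 𝔭' ∅ γ) 0).map (PowerSeries.map (Summit.BirchSwinnertonDyer.Rank1Residual.X11b.Halves.toUnr 3)) ⊔ Ideal.span {((3 : ℕ) : Literature.NumberTheory.EllipticCurves.UnrSeries 3) ^ m} ⊔ Ideal.span {((1 + PowerSeries.X) ^ (3 ^ m) - 1 : Literature.NumberTheory.EllipticCurves.UnrSeries 3)}

/-- **C⁺ = the MAZUR–TATE TOWER at the UTD frame (the transferred crux; displayed, not constructed).**
At every frame of the wall there are `μ` and layer elements `θ_m ∈ Λ = ℤ₃⟦T⟧` with
`θ̄_m ∈ Fitt_{Λ/(ω_m)}(X ⧸ ω_m X)` — a FITTING membership over the layer group ring `ℤ₃[Gal(K_m/K)]` of the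
layer module (= the dual layer Selmer group under control), the natural output of an equivariant
Kolyvagin/Stark-system argument at layer `m` (Sakamoto 2024 Thm 4.4 over `R = ℤ/3^k[G_m]`) — and the layer
reciprocity `3^μ · L ∈ (θ_m) + (3^m) + (ω_m)` in `R₀⟦T⟧` (p-adic Waldspurger at the finite-order characters
of `G_m`, LZZ, assembled integrally with an `m`-UNIFORM loss `μ`). [conjecture-grade research statement] -/
def MazurTateTowerAtThreeSurj : Prop :=
  ∀ (W : WeierstrassCurve ℚ) [W.IsElliptic] [W.IsGloballyMinimal] (N : ℕ) [NeZero N] (K : Type) [Field K] [NumberField K] (Dt : Literature.NumberTheory.EllipticCurves.ModularForms.ModularParametrizationData W N), Summit.BirchSwinnertonDyer.Rank1Residual.Additive.ClassO6 W 3 → W.HasSurjectiveModNGaloisRep 3 → W.analyticRank = 1 → W.conductorNorm ℤ = N → Literature.NumberTheory.EllipticCurves.IsImaginaryQuadratic K → Literature.NumberTheory.EllipticCurves.SatisfiesHeegnerHypothesis N K → ∀ (κ : Literature.NumberTheory.EllipticCurves.ZpExtension K 3), κ.IsAnticyclotomic → ∀ (γ : Field.absoluteGaloisGroup K) [Fact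 (κ.IsTopGenerator γ)] (𝔭 : IsDedekindDomain.HeightOneSpectrum (NumberField.RingOfIntegers K)), ((3 : ℕ) : NumberField.RingOfIntegers K) ∈ 𝔭.asIdeal → 𝔭.asIdeal.ramificationIdx (NumberField.RingOfIntegers ℚ) = 1 → 𝔭.asIdeal.inertiaDeg (NumberField.RingOfIntegers ℚ) = 1 → ∀ (𝔭' : IsDedekindDomain.HeightOneSpectrum (NumberField.RingOfIntegers K)), ((3 : ℕ) : NumberField.RingOfIntegers K) ∈ 𝔭'.asIdeal → 𝔭' ≠ 𝔭 → ∀ (ι' : PadicAlgCl 3 ≃+* ℂ), Summit.BirchSwinnertonDyer.BirchSwinnertonDyer.Theorems.SchneiderFree.BranchInducesPrime 3 ι' 𝔭 → ∀ (ΩK : ℂ) (Ωp : ℂ_[3]) (L : Literature.NumberTheory.EllipticCurves.UnrSeries 3), ΩK ≠ 0 → Ωp ≠ 0 → Literature.NumberTheory.EllipticCurves.IsBDPLFunction ι' 𝔭 κ γ Dt.f ΩK Ωp L → ∃ μ : ℕ, ∃ θ : ℕ → Literature.NumberTheory.EllipticCurves.IwasawaAlgebra 3, ∀ m : ℕ,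 (Ideal.Quotient.mk (Ideal.span {((1 + PowerSeries.X) ^ (3 ^ m) - 1 : Literature.NumberTheory.EllipticCurves.IwasawaAlgebra 3)}) (θ m) ∈ Literature.RingTheory.FittingIdeal.Module.fittingIdeal (Literature.NumberTheory.EllipticCurves.IwasawaAlgebra 3 ⧸ Ideal.span {((1 + PowerSeries.X) ^ (3 ^ m) - 1 : Literature.NumberTheory.EllipticCurves.IwasawaAlgebra 3)}) (Summit.BirchSwinnertonDyer.Rank1Residual.X11b.AcSelmer.XAc (W.baseChange K) 3 κ 𝔭' ∅ γ ⧸ (Ideal.span {((1 + PowerSeries.X) ^ (3 ^ m) - 1 : Literature.NumberTheory.EllipticCurves.IwasawaAlgebra 3)} • (⊤ : Submodule (Literature.NumberTheory.EllipticCurves.IwasawaAlgebra 3) (Summit.BirchSwinnertonDyer.Rank1Residual.X11b.AcSelmer.XAc (W.baseChange K) 3 κ 𝔭' ∅ γ)))) 0) ∧ ((3 : ℕ) : Literature.NumberTheory.EllipticCurves.UnrSeries 3) ^ μ * L ∈ Ideal.span {PowerSeries.map (Summit.BirchSwinnertonDyer.Rank1Residual.X11b.Halves.toUnr 3) (θ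 m)} ⊔ Ideal.span {((3 : ℕ) : Literature.NumberTheory.EllipticCurves.UnrSeries 3) ^ m} ⊔ Ideal.span {((1 + PowerSeries.X) ^ (3 ^ m) - 1 : Literature.NumberTheory.EllipticCurves.UnrSeries 3)}

/-- **Integral C⁺** (`μ = 0`): the Mazur–Tate tower with no `3`-power loss. -/
def IntegralMazurTateTowerAtThreeSurj : Prop :=
  ∀ (W : WeierstrassCurve ℚ) [W.IsElliptic] [W.IsGloballyMinimal] (N : ℕ) [NeZero N] (K : Type) [Field K] [NumberField K] (Dt : Literature.NumberTheory.EllipticCurves.ModularForms.ModularParametrizationData W N), Summit.BirchSwinnertonDyer.Rank1Residual.Additive.ClassO6 W 3 → W.HasSurjectiveModNGaloisRep 3 → W.analyticRank = 1 → W.conductorNorm ℤ = N → Literature.NumberTheory.EllipticCurves.IsImaginaryQuadratic K → Literature.NumberTheory.EllipticCurves.SatisfiesHeegnerHypothesis N K → ∀ (κ : Literature.NumberTheory.EllipticCurves.ZpExtension K 3), κ.IsAnticyclotomic → ∀ (γ : Field.absoluteGaloisGroup K) [Fact (κ.IsTopGenerator γ)] (𝔭 : IsDedekindDomain.HeightOneSpectrum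 (NumberField.RingOfIntegers K)), ((3 : ℕ) : NumberField.RingOfIntegers K) ∈ 𝔭.asIdeal → 𝔭.asIdeal.ramificationIdx (NumberField.RingOfIntegers ℚ) = 1 → 𝔭.asIdeal.inertiaDeg (NumberField.RingOfIntegers ℚ) = 1 → ∀ (𝔭' : IsDedekindDomain.HeightOneSpectrum (NumberField.RingOfIntegers K)), ((3 : ℕ) : NumberField.RingOfIntegers K) ∈ 𝔭'.asIdeal → 𝔭' ≠ 𝔭 → ∀ (ι' : PadicAlgCl 3 ≃+* ℂ), Summit.BirchSwinnertonDyer.BirchSwinnertonDyer.Theorems.SchneiderFree.BranchInducesPrime 3 ι' 𝔭 → ∀ (ΩK : ℂ) (Ωp : ℂ_[3]) (L : Literature.NumberTheory.EllipticCurves.UnrSeries 3), ΩK ≠ 0 → Ωp ≠ 0 → Literature.NumberTheory.EllipticCurves.IsBDPLFunction ι' 𝔭 κ γ Dt.f ΩK Ωp L → ∃ θ : ℕ → Literature.NumberTheory.EllipticCurves.IwasawaAlgebra 3, ∀ m : ℕ, (Ideal.Quotient.mk (Ideal.span {((1 + PowerSeries.X) ^ (3 ^ m) - 1 : Literature.NumberTheory.EllipticCurves.IwasawaAlgebra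 3)}) (θ m) ∈ Literature.RingTheory.FittingIdeal.Module.fittingIdeal (Literature.NumberTheory.EllipticCurves.IwasawaAlgebra 3 ⧸ Ideal.span {((1 + PowerSeries.X) ^ (3 ^ m) - 1 : Literature.NumberTheory.EllipticCurves.IwasawaAlgebra 3)}) (Summit.BirchSwinnertonDyer.Rank1Residual.X11b.AcSelmer.XAc (W.baseChange K) 3 κ 𝔭' ∅ γ ⧸ (Ideal.span {((1 + PowerSeries.X) ^ (3 ^ m) - 1 : Literature.NumberTheory.EllipticCurves.IwasawaAlgebra 3)} • (⊤ : Submodule (Literature.NumberTheory.EllipticCurves.IwasawaAlgebra 3) (Summit.BirchSwinnertonDyer.Rank1Residual.X11b.AcSelmer.XAc (W.baseChange K) 3 κ 𝔭' ∅ γ)))) 0) ∧ L ∈ Ideal.span {PowerSeries.map (Summit.BirchSwinnertonDyer.Rank1Residual.X11b.Halves.toUnr 3) (θ m)} ⊔ Ideal.span {((3 : ℕ) : Literature.NumberTheory.EllipticCurves.UnrSeries 3) ^ m} ⊔ Ideal.span {((1 + PowerSeries.X) ^ (3 ^ m) - 1 : Literature.NumberTheory.EllipticCurves.UnrSeries 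3)}

/-- **Residual Selmer finiteness at `E`** on the UTD frame: `Sel_{𝔭′}(K_∞, E[3^∞])[3]` finite (`μ_alg = 0` in
Greenberg's shape). On route UniversalToricDescent this is the OUTPUT of the mod-`3` transport from the twin
(`InvariantsTransportModThree` / `ToricTransportModThreeFlat`, read back through
`finite_pTorsion_of_isTorsion_of_exists_generator`); displayed here, not constructed. -/
def ResidualSelmerFiniteAtThreeSurj : Prop :=
  ∀ (W : WeierstrassCurve ℚ) [W.IsElliptic] [W.IsGloballyMinimal] (N : ℕ) [NeZero N] (K : Type) [Field K] [NumberField K], Summit.BirchSwinnertonDyer.Rank1Residual.Additive.ClassO6 W 3 → W.HasSurjectiveModNGaloisRep 3 → W.analyticRank = 1 → W.conductorNorm ℤ = N → Literature.NumberTheory.EllipticCurves.IsImaginaryQuadratic K → Literature.NumberTheory.EllipticCurves.SatisfiesHeegnerHypothesis N K → ∀ (κ : Literature.NumberTheory.EllipticCurves.ZpExtension K 3), κ.IsAnticyclotomic → ∀ (𝔭' : IsDedekindDomain.HeightOneSpectrum (NumberField.RingOfIntegers K)), ((3 : ℕ) : NumberField.RingOfIntegers K) ∈ 𝔭'.asIdeal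 → Set.Finite {s : Summit.BirchSwinnertonDyer.Rank1Residual.X11b.AcSelmer.selmerAc (W.baseChange K) 3 κ 𝔭' ∅ | (3 : ℕ) • s = 0}

/-! ### §2 The wall IS its integral `Ch`-layer tower (Krull door, by name) -/

/-- **20395 ⟸ the integral `Ch`-layer tower** (the layer door `mem_of_forall_mem_sup_layer` of the sibling
route, applied at the UTD frame). [cite: StacksProject, Tag 00IP] [cite: MazurTate1987, §1] -/
theorem additiveSplitIMCInclusionAtThree_of_integralCharLayerTower (hT : IntegralCharLayerTowerAtThreeSurj) :
    Summit.BirchSwinnertonDyer.BirchSwinnertonDyer.Theses.UniversalToricDescent.AdditiveSplitIMCInclusionAtThree := by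
  intro W _ _ N _ K _ _ Dt hO6 hsurj hr hN hK hHg κ hκ γ _ 𝔭 h𝔭 he hf 𝔭' h𝔭' hne ι' hι ΩK Ωp L hΩK hΩp hBDP
  rw [Ideal.span_singleton_le_iff_mem]
  exact mem_of_forall_mem_sup_layer (p := 3) _
    (hT W N K Dt hO6 hsurj hr hN hK hHg κ hκ γ 𝔭 h𝔭 he hf 𝔭' h𝔭' hne ι' hι ΩK Ωp L hΩK hΩp hBDP)

/-- **20395 ⟺ its integral `Ch`-layer tower** (converse trivial). An equivalence: the layer format loses
nothing and — unlike orders/values/λ/μ along the tower (barrier note B-g33-1) — certifies the wall. -/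
theorem additiveSplitIMCInclusionAtThree_iff_integralCharLayerTower :
    Summit.BirchSwinnertonDyer.BirchSwinnertonDyer.Theses.UniversalToricDescent.AdditiveSplitIMCInclusionAtThree ↔
      IntegralCharLayerTowerAtThreeSurj := by
  refine ⟨fun hW ↦ ?_, additiveSplitIMCInclusionAtThree_of_integralCharLayerTower⟩
  intro W _ _ N _ K _ _ Dt hO6 hsurj hr hN hK hHg κ hκ γ _ 𝔭 h𝔭 he hf 𝔭' h𝔭' hne ι' hι ΩK Ωp L hΩK hΩp hBDP m
  have h := hW W N K Dt hO6 hsurj hr hN hK hHg κ hκ γ 𝔭 h𝔭 he hf 𝔭' h𝔭' hne ι' hι ΩK Ωp L hΩK hΩp hBDP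
  rw [Ideal.span_singleton_le_iff_mem] at h
  exact Ideal.mem_sup_left (Ideal.mem_sup_left h)

/-! ### §3 C⁺ ⟹ (LT) ⟹ the wall (with residual finiteness at `E`), and the integral C⁺ ⟹ the wall -/

/-- **C⁺ ⟹ (LT)**, exponent preserved (Stacks 07ZA (3): a Fitting membership over `Λ/(ω_m)` lifts into
`Fitt_Λ(X) + (ω_m)`; sibling lemma `forall_pow_mul_mem_map_fittingIdeal_sup_layer_of_quotientFitting`).
[cite: StacksProject, Tag 07ZA] [cite: KimKurihara2021, §1] -/
theorem fittingLayerTower_of_mazurTateTower (hMT : MazurTateTowerAtThreeSurj) : FittingLayerTowerAtThreeSurj := by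
  intro W _ _ N _ K _ _ Dt hO6 hsurj hr hN hK hHg κ hκ γ _ 𝔭 h𝔭 he hf 𝔭' h𝔭' hne ι' hι ΩK Ωp L hΩK hΩp hBDP
  haveI : (W.baseChange K).IsElliptic := inferInstanceAs (W.map (algebraMap ℚ K)).IsElliptic
  haveI : Module.Finite (IwasawaAlgebra 3) (XAc (W.baseChange K) 3 κ 𝔭' ∅ γ) := XAc.module_finite_empty κ 𝔭' γ
  obtain ⟨μ, θ, hθ⟩ := hMT W N K Dt hO6 hsurj hr hN hK hHg κ hκ γ 𝔭 h𝔭 he hf 𝔭' h𝔭' hne ι' hι ΩK Ωp L hΩK hΩp hBDP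
  exact ⟨μ, fun m ↦ forall_pow_mul_mem_map_fittingIdeal_sup_layer_of_quotientFitting (p := 3) μ θ
    (fun m ↦ (hθ m).1) (fun m ↦ (hθ m).2) m⟩

/-- **(LT) ∧ residual finiteness at `E` ⟹ the wall 20395.** `Fitt ⊆ Ch` (Skinner–Urban §3.1.6), the layer
door (Krull), then UTD's Greenberg criterion (`Ch·R₀⟦T⟧ = (g)`, `g` with a norm-one coefficient, from the
finiteness of `Sel[3]`) and saturation at `3` remove `3^μ`. [cite: SkinnerUrban2014, §3.1.6]
[cite: GreenbergVatsal2000, §2 Prop. (2.8)] [cite: StacksProject, Tag 00IP] -/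
theorem additiveSplitIMCInclusionAtThree_of_residualFinite_of_fittingLayerTower
    (hfinF : ResidualSelmerFiniteAtThreeSurj) (hLT : FittingLayerTowerAtThreeSurj) :
    Summit.BirchSwinnertonDyer.BirchSwinnertonDyer.Theses.UniversalToricDescent.AdditiveSplitIMCInclusionAtThree := by
  intro W _ _ N _ K _ _ Dt hO6 hsurj hr hN hK hHg κ hκ γ _ 𝔭 h𝔭 he hf 𝔭' h𝔭' hne ι' hι ΩK Ωp L hΩK hΩp hBDP
  haveI : (W.baseChange K).IsElliptic := inferInstanceAs (W.map (algebraMap ℚ K)).IsElliptic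
  haveI : Module.Finite (IwasawaAlgebra 3) (XAc (W.baseChange K) 3 κ 𝔭' ∅ γ) := XAc.module_finite_empty κ 𝔭' γ
  obtain ⟨μ, hμ⟩ := hLT W N K Dt hO6 hsurj hr hN hK hHg κ hκ γ 𝔭 h𝔭 he hf 𝔭' h𝔭' hne ι' hι ΩK Ωp L hΩK hΩp hBDP
  -- tempered `Ch`-membership by the layer door
  have hCh : ((3 : ℕ) : UnrSeries 3) ^ μ * L ∈
      (XAc.charIdeal (W.baseChange K) 3 κ 𝔭' ∅ γ).map (PowerSeries.map (Halves.toUnr 3)) := by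
    refine mem_of_forall_mem_sup_layer (p := 3) _ fun m ↦ ?_
    have hle := sup_le_sup_right (sup_le_sup_right
      (map_fittingIdeal_le_map_charIdeal (W.baseChange K) 3 κ 𝔭' γ (PowerSeries.map (Halves.toUnr 3)))
      (Ideal.span {((3 : ℕ) : UnrSeries 3) ^ m}))
      (Ideal.span {((1 + PowerSeries.X) ^ (3 ^ m) - 1 : UnrSeries 3)})
    exact hle (hμ m)
  -- Greenberg's criterion at `E` and saturation at `3`
  have hfin := hfinF W N K hO6 hsurj hr hN hK hHg κ hκ 𝔭' h𝔭'
  obtain ⟨_, g, hg, n, hn⟩ :=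
    isTorsion_and_exists_generator_of_finite_pTorsion (W.baseChange K) 3 κ 𝔭' ∅ γ Set.finite_empty hfin
  rw [hg] at hCh ⊢
  rw [← three_eq_natCast] at hCh
  exact span_le_span_of_span_pow_three_mul_le L g μ n hn ((Ideal.span_singleton_le_iff_mem _).mpr hCh)

/-- **C⁺ ∧ residual finiteness at `E` ⟹ the wall 20395** (the transfer's concluding implication). -/
theorem additiveSplitIMCInclusionAtThree_of_residualFinite_of_mazurTateTower
    (hfinF : ResidualSelmerFiniteAtThreeSurj) (hMT : MazurTateTowerAtThreeSurj) :
    Summit.BirchSwinnertonDyer.BirchSwinnertonDyer.Theses.UniversalToricDescent.AdditiveSplitIMCInclusionAtThree :=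
  additiveSplitIMCInclusionAtThree_of_residualFinite_of_fittingLayerTower hfinF
    (fittingLayerTower_of_mazurTateTower hMT)

/-- **Integral C⁺ ⟹ the wall 20395, with NO finiteness / μ input** (`Fitt ⊆ Ch` + the layer door). -/
theorem additiveSplitIMCInclusionAtThree_of_integralMazurTateTower (hMT : IntegralMazurTateTowerAtThreeSurj) :
    Summit.BirchSwinnertonDyer.BirchSwinnertonDyer.Theses.UniversalToricDescent.AdditiveSplitIMCInclusionAtThree := by
  refine additiveSplitIMCInclusionAtThree_of_integralCharLayerTower ?_
  intro W _ _ N _ K _ _ Dt hO6 hsurj hr hN hK hHg κ hκ γ _ 𝔭 h𝔭 he hf 𝔭' h𝔭' hne ι' hι ΩK Ωp L hΩK hΩp hBDP m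
  haveI : (W.baseChange K).IsElliptic := inferInstanceAs (W.map (algebraMap ℚ K)).IsElliptic
  haveI : Module.Finite (IwasawaAlgebra 3) (XAc (W.baseChange K) 3 κ 𝔭' ∅ γ) := XAc.module_finite_empty κ 𝔭' γ
  obtain ⟨θ, hθ⟩ := hMT W N K Dt hO6 hsurj hr hN hK hHg κ hκ γ 𝔭 h𝔭 he hf 𝔭' h𝔭' hne ι' hι ΩK Ωp L hΩK hΩp hBDP
  have h := forall_pow_mul_mem_map_fittingIdeal_sup_layer_of_quotientFitting (p := 3)
    (Y := XAc (W.baseChange K) 3 κ 𝔭' ∅ γ) 0 θ (L := L) (fun m ↦ (hθ m).1)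
    (fun m ↦ by rw [pow_zero, one_mul]; exact (hθ m).2) m
  rw [pow_zero, one_mul] at h
  exact (sup_le_sup_right (sup_le_sup_right
    (map_fittingIdeal_le_map_charIdeal (W.baseChange K) 3 κ 𝔭' γ (PowerSeries.map (Halves.toUnr 3)))
    (Ideal.span {((3 : ℕ) : UnrSeries 3) ^ m}))
    (Ideal.span {((1 + PowerSeries.X) ^ (3 ^ m) - 1 : UnrSeries 3)})) h

end Summit.BirchSwinnertonDyer.BirchSwinnertonDyer.Cruxes.AdditiveSplitIMCInclusionAtThree.LayerFittingTransfer

end
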